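import Summits.QuantumFields.YangMills.Theorems.BalabanUVNodesN22WindowedNE9OutputLevel

/-!
# BalabanUVNodes ∕ node N22 = NE9 (value side, the (D4) road's input) — THE VALUE LETTER `WindowedDecay F (localizedSum F S emb) …` FROM OUTPUT-LEVEL DATA ONLY:
# the PRINTED (1.18) bound of the (2.13) terms on the complex spaces (node00-def-W1's printed-type predicate `TermBound118`) + holomorphy of the terms through the
# complexified readings + the minimizer tails — NO activity-level slot, NO (2.38), NO Road-1 numerals

Cell `pub-ymgap`, HUMAN RULING D-0062 (Track A), R134 seat `pub-ymgap-dag-n22-c` (strategy s1), generation 13, module J36 (value twin of J34).  THEOREMS ONLY (no `def`, no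
`sorry`); imports J34 `…Theorems.BalabanUVNodesN22WindowedNE9OutputLevel` (p613551; through it J29 v1.1's `abs_polWindow_localizedSum_le_soft`, dag-n22-w2's capstone
engine `windowedDecay_localizedSum_of_softSum`, node00-def-W1's `TermBound118` ∕ `termC_succ`) — consumed BY NAME.  Filed `--supports stmt-QuantumFields-20544` (K3⁷) as a HELPER.

WHY.  K3⁷ v5 §2b reads, next to the history-Lipschitz letter `h9`, the VALUE letter `hdec` (`KernelDecayOfRecord₁₃`, from W1-19b's `WindowedDecay` at the localized sum — the
windowed (5.10) decay; dag-n22-w2's (B) p606885, dag-n22-w5's p608801).  The road of record (A) `windowedDecay_localizedSum_of_activitySlots` feeds it from W1's ACTIVITY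
slot `Bound238` ((2.38)) + activity holomorphy + Road 1's numerals.  But J29 v1.1's value interface is TERM-level, and the term-level value datum is PRINTED: [I] (1.18) p. 263
«|𝐄^{(j)}(X, …)| ≤ E₀ exp(−κ d_j(X))» on the complex spaces `U^c_j(X, α₀, α₁)` — node00-def-W1's printed-type predicate `W1.TermBound118 S W sp E₀ κ`.  THIS FILE (J34's
value twin) types the shortest road: `TermBound118` BY NAME + term holomorphy through the readings + tails ⟹ `WindowedDecay`.  No activity-level hypothesis remains on the
value side either.

WHAT (0 `def`, 0 `sorry`).  §1 `outputValueSummand_le_softMajorant` (real arithmetic) · `abs_polWindow_localizedSum_le_soft_of_outputBound` (J29 v1.1 with the term bound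
`‖E^{(k+1)}(X; hist; φ)‖ ≤ B e^{−κ_E d_{k+1}(X)}` on `sp X` and (C1) displayed at output level); §2 ★★★ `windowedDecay_localizedSum_of_outputBound` (the value letter from a
displayed term bound at the window histories + term holomorphy through the readings + tails; constant `C₀ = (16·B·B₃²∕r²)e^{12Mδ₁}K₀(64,8)K₁(4,δ₀∕2)`); ★★★
`windowedDecay_localizedSum_of_termBound118` (the same with the term bound LITERALLY node00-def-W1's `TermBound118 (S K) W (spj K) B κ_E` — printed (1.18) on the space
tables — via `termC_succ`).

HONEST FRAMING.  Count-neutral helper ∕ junction; the only estimate used is J28's Cauchy bound inside J29 v1.1.  DISPLAYED with owners: the printed (1.18) term bound on the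
complex space tables (`TermBound118`: node N10's Lemmas 1–3 ⟹ (2.41) ⟹ (1.18), NODE A at the towers of record — in the tree from the activity level by this lane's strip
lineage `termBound118_of_stripBound` ∕ J30 v1.1), term holomorphy through the complexified readings ([II] p. 15 + chain rule), the readings' chart ∕ space clauses at `X`,
the tails ([I] p. 282).  Nothing of Bałaban's is constructed; N22 ∕ (D4) NOT discharged (typed 28∕28 · discharged 5∕27 UNCHANGED); K3⁷ OPEN; one finite four-torus programme
at fixed ε — NOT infinite volume, NOT OS on ℝ⁴, NOT a mass gap, NOT Clay.  0 `sorry`, 0 `def`, standard axioms.  References (TYPES only): [I] = [Balaban1987RG1] CMP 109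
(1987) (1.7) p. 261, (1.18) p. 263, (1.20)–(1.21) p. 264, p. 282, (5.10) p. 293; [II] = [Balaban1988RG2Cluster] CMP 116 (1988) (2.13) p. 14, p. 15, (2.41) p. 21.
-/

noncomputable section

open Filter Topology Set Metric
open scoped BigOperators

namespace YMDAG.N22.OutputLevel

open Literature.MathematicalPhysics.QuantumFieldTheory.Balaban1983to89
open Literature.MathematicalPhysics.QuantumFieldTheory.Balaban1983to89.T4Continuum (T4Family)
open Literature.MathematicalPhysics.QuantumFieldTheory.Balaban1983to89.T4OutputRate (Window)
open Literature.MathematicalPhysics.QuantumFieldTheory.Balaban1983to89.TreeLengthTorus (TPt torusTreeLen torusTreeLen_nonneg)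
open Literature.MathematicalPhysics.QuantumFieldTheory.Balaban1983to89.B12TreeDecay (K₀ kappa₀ K₀_pos)
open Literature.MathematicalPhysics.QuantumFieldTheory.Balaban1983to89.B12PolarizationTensor120 (expChart expChart_apply)
open Literature.MathematicalPhysics.QuantumFieldTheory.Balaban1983to89.B12Decay510 (delta1)
open Literature.MathematicalPhysics.QuantumFieldTheory.Balaban1983to89.B12Decay510Window (K₁)
open Literature.MathematicalPhysics.QuantumFieldTheory.Balaban1983to89.B12Decay510Torus (distCT nearT)
open Literature.MathematicalPhysics.QuantumFieldTheory.Balaban1983to89.Node00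
open Literature.MathematicalPhysics.QuantumFieldTheory.Balaban1983to89.Node00.Sect2 (domSys domCount CPair)
open Literature.MathematicalPhysics.QuantumFieldTheory.Balaban1983to89.Node00.W1
open Literature.MathematicalPhysics.QuantumFieldTheory.Balaban1983to89.Node00.LocalizedSum17 (localizedSum ReadingMaps)
open Literature.MathematicalPhysics.QuantumFieldTheory.Balaban1983to89.Node00.U3OfKernels (histPrefix histPrefix_apply)
open Literature.MathematicalPhysics.QuantumFieldTheory.Balaban1983to89.Node00.U3KernelLetters (WindowedDecay)
open YMDAG.N22.WindowOfLocalTerms (abs_polWindow_localizedSum_le_soft)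
open YMDAG.N22.WindowSoftTwoPoint (windowedDecay_localizedSum_of_softSum)

/-! ## §1 The soft windowed VALUE bound of the (1.7) localized sum from an OUTPUT-level term bound -/

/-- **REAL ARITHMETIC**: the soft value summand `16·(B e^{−κ_E d})∕r²·(w_z·w_0)` under the tails `w_z ≤ B₃e_z`, `w_0 ≤ B₃e_0` and `κ ≤ κ_E`, `d ≥ 0` is at most
`(16·B·B₃²∕r²)·1·e^{−κd}·e_z·e_0`. [folklore] -/
theorem outputValueSummand_le_softMajorant {B r wz w0 B₃ ez e0 κ κE d : ℝ} (hB : 0 ≤ B) (hr : 0 < r) (hB₃ : 0 ≤ B₃)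
    (hw0 : 0 ≤ w0) (hez : 0 ≤ ez) (he0 : 0 ≤ e0) (hz : wz ≤ B₃ * ez) (h0 : w0 ≤ B₃ * e0) (hκ : κ ≤ κE) (hd : 0 ≤ d) :
    16 * (B * Real.exp (-(κE * d))) / r ^ 2 * (wz * w0) ≤ (16 * B * B₃ ^ 2 / r ^ 2) * 1 * Real.exp (-κ * d) * ez * e0 := by
  have h2 : wz * w0 ≤ (B₃ * ez) * (B₃ * e0) := mul_le_mul hz h0 hw0 (mul_nonneg hB₃ hez)
  have hexp : Real.exp (-(κE * d)) ≤ Real.exp (-κ * d) := by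
    rw [neg_mul]
    exact Real.exp_le_exp.2 (neg_le_neg (mul_le_mul_of_nonneg_right hκ hd))
  have h3 : 0 ≤ 16 * (B * Real.exp (-(κE * d))) / r ^ 2 := by positivity
  have h4 : 0 ≤ 16 * B / r ^ 2 * ((B₃ * ez) * (B₃ * e0)) := by positivity
  calc 16 * (B * Real.exp (-(κE * d))) / r ^ 2 * (wz * w0)
      ≤ 16 * (B * Real.exp (-(κE * d))) / r ^ 2 * ((B₃ * ez) * (B₃ * e0)) := mul_le_mul_of_nonneg_left h2 h3
    _ = 16 * B / r ^ 2 * ((B₃ * ez) * (B₃ * e0)) * Real.exp (-(κE * d)) := by ring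
    _ ≤ 16 * B / r ^ 2 * ((B₃ * ez) * (B₃ * e0)) * Real.exp (-κ * d) := mul_le_mul_of_nonneg_left hexp h4
    _ = (16 * B * B₃ ^ 2 / r ^ 2) * 1 * Real.exp (-κ * d) * ez * e0 := by ring

section Window

variable {𝔄 : Type*} [NormedRing 𝔄] [NormedAlgebra ℝ 𝔄] {V : Type*} [NormedAddCommGroup V] [NormedSpace ℝ V] {ι' : Type*} [Fintype ι']
  {𝔸 : Type*} {M : ℕ} (F : T4Family) (S : (K : ℕ) → ClusterTower (F.P K) 𝔸 M) (emb : ReadingMaps F 𝔄 𝔸) (ρ : V →L[ℝ] 𝔄)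
  (bV : Module.Basis ι' ℝ V) (k K : ℕ) {Ec : Type*} [NormedAddCommGroup Ec] [NormedSpace ℂ Ec]

open Classical in
/-- **THE SOFT WINDOWED VALUE BOUND FROM AN OUTPUT-LEVEL TERM BOUND.**  J29 v1.1's `abs_polWindow_localizedSum_le_soft` at ONE prefix `hist` with `‖G X‖ ≤ M X` supplied by a
DISPLAYED term bound `‖E^{(k+1)}(X; hist; φ)‖ ≤ B·e^{−κ_E d_{k+1}(X)}` on the configurations of `sp X` ([I] (1.18) on the complex space) at the complexified configurations
`Φ_X z ∈ sp X`, and (C1) displayed at output level. [cite: Balaban1987RG1, (1.7) p.261, (1.18) p.263, (1.20)-(1.21) p.264, (4.35)-(4.37) pp.290-291 and (5.10) p.293; Balaban1988RG2Cluster, (2.13) p.14 and p.15] -/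
theorem abs_polWindow_localizedSum_le_soft_of_outputBound
    (sp : (domSys (F.P K) M (k + 1)).Dom → Set (CPair (F.P K) 𝔸)) {B κE : ℝ} {hist : Fin (k + 1) → ℝ}
    (hbd : ∀ (X : (domSys (F.P K) M (k + 1)).Dom), ∀ φ ∈ sp X, ‖((S K) k).E hist φ X‖ ≤ B * Real.exp (-(κE * (domSys (F.P K) M (k + 1)).dj X)))
    (ι : (domSys (F.P K) M (k + 1)).Dom → ((Fin (F.P K).d → Site (F.P K) (k + 1) → V) →L[ℝ] Ec))
    (Φ : (domSys (F.P K) M (k + 1)).Dom → Ec → CPair (F.P K) 𝔸)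
    (U : (domSys (F.P K) M (k + 1)).Dom → Set Ec) (hU : ∀ X, IsOpen (U X)) {r : ℝ} (hr : 0 < r) (hrU : ∀ X, ball (0 : Ec) r ⊆ U X)
    (hEhol : ∀ X, DifferentiableOn ℂ (fun z => ((S K) k).E hist (Φ X z) X) (U X))
    (hΦemb : ∀ X (Bp : Fin (F.P K).d → Site (F.P K) (k + 1) → V), Φ X (ι X Bp) = emb K k (fun l t => NormedSpace.exp (ρ (Bp l t))))
    (hΦsp : ∀ X, ∀ z ∈ ball (0 : Ec) r, Φ X z ∈ sp X)
    (w : (domSys (F.P K) M (k + 1)).Dom → Site (F.P K) (k + 1) → ℝ)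
    (hw₀ : ∀ X t, 0 ≤ w X t) (hw : ∀ X (l : Fin (F.P K).d) (t : Site (F.P K) (k + 1)) (c : ι'), ‖ι X (Pi.single l (Pi.single t (bV c)))‖ ≤ w X t)
    (μ ν : Fin 4) (z : Fin 4 → ℤ) :
    |polWindow F K (k + 1) (localizedSum F S emb k hist K) ρ bV μ ν z| ≤
      ∑ X : (domSys (F.P K) M (k + 1)).Dom,
        16 * (B * Real.exp (-(κE * torusTreeLen X.1))) / r ^ 2 * (w X (siteOfInt F K (k + 1) z) * w X (siteOfInt F K (k + 1) 0)) :=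
  abs_polWindow_localizedSum_le_soft F S emb ρ bV k K hist ι (fun X z => ((S K) k).E hist (Φ X z) X) U hU hEhol hr hrU
    (fun X Bp => by rw [expChart_apply, hΦemb]) (fun X => B * Real.exp (-(κE * torusTreeLen X.1)))
    (fun X z hz => hbd X (Φ X z) (hΦsp X z hz)) w hw₀ hw μ ν z

end Window

/-! ## §2 ★★★ THE VALUE LETTER `WindowedDecay F (localizedSum F S emb) …` FROM OUTPUT-LEVEL DATA ONLY -/

section Letter

variable (F : T4Family) {𝔄 : Type*} [NormedRing 𝔄] [NormedAlgebra ℝ 𝔄] {V : Type*} [NormedAddCommGroup V] [NormedSpace ℝ V]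
  {ι' : Type*} [Fintype ι'] {𝔸 : Type*} {M : ℕ}

open Classical in
/-- ★★★ **THE VALUE LETTER FROM AN OUTPUT-LEVEL TERM BOUND.**  For node00-def-W1's term family `localizedSum F S emb`, a window `W`, cube side `M = L^{m′}`: IF at every window
history `g ∈ W`, tower `K`, level `k`, domain `X` and configuration `φ ∈ sp K k X` the (2.13) term obeys `‖E^{(k+1)}(X; histPrefix g k; φ)‖ ≤ B·e^{−κ_E d_{k+1}(X)}` ([I] (1.18) on
the complex space — DISPLAYED; `0 ≤ B`, `κ ≤ κ_E`); IF per `(K, k, X)` the complexified probe reading `Φ K k X` on an open `U K k X ⊇ ball 0 r` extends the exponential chart's reading,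
maps the ball into `sp K k X` and makes the TERM `z ↦ E^{(k+1)}(X; histPrefix g k; Φ K k X z)` holomorphic (DISPLAYED at output level); IF the site weights carry the tails
`w ≤ B₃e^{−δ₀ distCT(·, X)}`, `δ₀ > 0`, `2κ₀(64,8) ≤ κ`: THEN W1-19b's value binder `WindowedDecay F (localizedSum F S emb) ρ bV W μ ν δ₁` holds, `δ₁ = ½min{δ₀, κ(4M)⁻¹}`, with the
constant `C₀ = (16·B·B₃²∕r²)·e^{12Mδ₁}K₀(64,8)K₁(4,δ₀∕2)` — §1 composed with dag-n22-w2's `windowedDecay_localizedSum_of_softSum` BY NAME.  NO activity-level hypothesis, NO (2.38),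
NO Road-1 numerals. [cite: Balaban1987RG1, (1.7) p.261, (1.18) p.263, (1.20)-(1.21) p.264 and (5.10) p.293; Balaban1988RG2Cluster, (2.13) p.14, p.15 and (2.41) p.21] -/
theorem windowedDecay_localizedSum_of_outputBound (m' : ℕ) (M : ℕ) [NeZero M] (hM : M = F.L ^ m')
    (S : (K : ℕ) → ClusterTower (F.P K) 𝔸 M) (emb : ReadingMaps F 𝔄 𝔸) (ρ : V →L[ℝ] 𝔄) (bV : Module.Basis ι' ℝ V)
    (W : Set (ℕ → ℝ)) (sp : (K k : ℕ) → (domSys (F.P K) M (k + 1)).Dom → Set (CPair (F.P K) 𝔸))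
    {κ κE δ₀ B₃ r B : ℝ} (hκ₀ : kappa₀ (4 * 2 ^ 4) (2 * 4) ≤ κ / 2) (hδ₀ : 0 < δ₀) (hB₃ : 0 ≤ B₃) (hr : 0 < r) (hB : 0 ≤ B) (hκE : κ ≤ κE)
    (hbd : ∀ g ∈ W, ∀ (K k : ℕ) (X : (domSys (F.P K) M (k + 1)).Dom), ∀ φ ∈ sp K k X,
      ‖((S K) k).E (histPrefix g k) φ X‖ ≤ B * Real.exp (-(κE * (domSys (F.P K) M (k + 1)).dj X)))
    (Ec : ℕ → ℕ → Type*) [∀ K k, NormedAddCommGroup (Ec K k)] [∀ K k, NormedSpace ℂ (Ec K k)]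
    (ι : (K k : ℕ) → (domSys (F.P K) M (k + 1)).Dom → ((Fin (F.P K).d → Site (F.P K) (k + 1) → V) →L[ℝ] Ec K k))
    (Φ : (K k : ℕ) → (domSys (F.P K) M (k + 1)).Dom → Ec K k → CPair (F.P K) 𝔸)
    (U : (K k : ℕ) → (domSys (F.P K) M (k + 1)).Dom → Set (Ec K k)) (hU : ∀ K k X, IsOpen (U K k X)) (hrU : ∀ K k X, ball (0 : Ec K k) r ⊆ U K k X)
    (hEhol : ∀ g ∈ W, ∀ (K k : ℕ) (X : (domSys (F.P K) M (k + 1)).Dom),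
      DifferentiableOn ℂ (fun z => ((S K) k).E (histPrefix g k) (Φ K k X z) X) (U K k X))
    (hΦemb : ∀ (K k : ℕ) (X : (domSys (F.P K) M (k + 1)).Dom) (Bp : Fin (F.P K).d → Site (F.P K) (k + 1) → V),
      Φ K k X (ι K k X Bp) = emb K k (fun l t => NormedSpace.exp (ρ (Bp l t))))
    (hΦsp : ∀ (K k : ℕ) (X : (domSys (F.P K) M (k + 1)).Dom), ∀ z ∈ ball (0 : Ec K k) r, Φ K k X z ∈ sp K k X)
    (w : (K k : ℕ) → (domSys (F.P K) M (k + 1)).Dom → Site (F.P K) (k + 1) → ℝ) (hw₀ : ∀ K k X t, 0 ≤ w K k X t)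
    (hw : ∀ (K k : ℕ) (X : (domSys (F.P K) M (k + 1)).Dom) (l : Fin (F.P K).d) (t : Site (F.P K) (k + 1)) (c : ι'),
      ‖ι K k X (Pi.single l (Pi.single t (bV c)))‖ ≤ w K k X t)
    (htail : ∀ (K k : ℕ) (X : (domSys (F.P K) M (k + 1)).Dom) (t : Site (F.P K) (k + 1)),
      let e : Site (F.P K) (k + 1) → TPt 4 (domCount (F.P K) M (k + 1) * M) := fun x i => (ZMod.cast (x i) : ZMod (domCount (F.P K) M (k + 1) * M))
      w K k X t ≤ B₃ * Real.exp (-δ₀ * distCT (domCount (F.P K) M (k + 1)) M (e t) (nearT (M := M) (e t) X)))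
    (μ ν : Fin 4) :
    WindowedDecay F (localizedSum F S emb) ρ bV W μ ν (delta1 δ₀ κ ((M : ℝ) * 4)) := by
  have hCE : (0 : ℝ) ≤ 16 * B * B₃ ^ 2 / r ^ 2 := by positivity
  refine windowedDecay_localizedSum_of_softSum F m' M hM S emb ρ bV W hCE zero_le_one hδ₀ hκ₀ μ ν
    (fun g k z K X => 16 * (B * Real.exp (-(κE * torusTreeLen X.1))) / r ^ 2 * (w K k X (siteOfInt F K (k + 1) z) * w K k X (siteOfInt F K (k + 1) 0)))
    (fun g hg k z K => ?_) (fun g hg k z K X => ?_)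
  · exact abs_polWindow_localizedSum_le_soft_of_outputBound F S emb ρ bV k K (sp K k) (hbd g hg K k) (ι K k) (Φ K k) (U K k) (hU K k) hr (hrU K k)
      (hEhol g hg K k) (hΦemb K k) (hΦsp K k) (w K k) (hw₀ K k) (hw K k) μ ν z
  · exact outputValueSummand_le_softMajorant hB hr hB₃ (hw₀ K k X _) (Real.exp_nonneg _) (Real.exp_nonneg _) (htail K k X _) (htail K k X _) hκE
      (torusTreeLen_nonneg _)

open Classical in
/-- ★★★ **THE VALUE LETTER FROM node00-def-W1's PRINTED-TYPE PREDICATE `TermBound118`.**  As `windowedDecay_localizedSum_of_outputBound` with the term bound DISCHARGED BY NAME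
from `W1.TermBound118 (S K) W (spj K) B κ_E` — [I] (1.18) «|𝐄^{(j)}(X, …)| ≤ E₀ exp(−κ d_j(X))» for every history of `W`, level `j` and configuration of the space table
`spj K j` — at the levels `j = k + 1` (`termC_succ`: the window history's prefix IS `histPrefix g k`); the space tables of the readings are `sp K k := spj K (k+1)`.  The (D4)
road's windowed (5.10) input (`hdec` of K3⁷ v5 §2b, via W1-19b ∕ dag-n22-w3's `kernelDecay_of_windowed`) then reads PRINTED (1.18) + term holomorphy through the readings + tails.
[cite: Balaban1987RG1, (1.7) p.261, (1.18) p.263, (1.20)-(1.21) p.264 and (5.10) p.293; Balaban1988RG2Cluster, (2.13) p.14, p.15 and (2.41) p.21] -/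
theorem windowedDecay_localizedSum_of_termBound118 (m' : ℕ) (M : ℕ) [NeZero M] (hM : M = F.L ^ m')
    (S : (K : ℕ) → ClusterTower (F.P K) 𝔸 M) (emb : ReadingMaps F 𝔄 𝔸) (ρ : V →L[ℝ] 𝔄) (bV : Module.Basis ι' ℝ V)
    (W : Set (ℕ → ℝ)) (spj : (K j : ℕ) → (domSys (F.P K) M j).Dom → Set (CPair (F.P K) 𝔸))
    {κ κE δ₀ B₃ r B : ℝ} (hκ₀ : kappa₀ (4 * 2 ^ 4) (2 * 4) ≤ κ / 2) (hδ₀ : 0 < δ₀) (hB₃ : 0 ≤ B₃) (hr : 0 < r) (hB : 0 ≤ B) (hκE : κ ≤ κE)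
    (hT : ∀ K : ℕ, TermBound118 (S K) W (spj K) B κE)
    (Ec : ℕ → ℕ → Type*) [∀ K k, NormedAddCommGroup (Ec K k)] [∀ K k, NormedSpace ℂ (Ec K k)]
    (ι : (K k : ℕ) → (domSys (F.P K) M (k + 1)).Dom → ((Fin (F.P K).d → Site (F.P K) (k + 1) → V) →L[ℝ] Ec K k))
    (Φ : (K k : ℕ) → (domSys (F.P K) M (k + 1)).Dom → Ec K k → CPair (F.P K) 𝔸)
    (U : (K k : ℕ) → (domSys (F.P K) M (k + 1)).Dom → Set (Ec K k)) (hU : ∀ K k X, IsOpen (U K k X)) (hrU : ∀ K k X, ball (0 : Ec K k) r ⊆ U K k X)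
    (hEhol : ∀ g ∈ W, ∀ (K k : ℕ) (X : (domSys (F.P K) M (k + 1)).Dom),
      DifferentiableOn ℂ (fun z => ((S K) k).E (histPrefix g k) (Φ K k X z) X) (U K k X))
    (hΦemb : ∀ (K k : ℕ) (X : (domSys (F.P K) M (k + 1)).Dom) (Bp : Fin (F.P K).d → Site (F.P K) (k + 1) → V),
      Φ K k X (ι K k X Bp) = emb K k (fun l t => NormedSpace.exp (ρ (Bp l t))))
    (hΦsp : ∀ (K k : ℕ) (X : (domSys (F.P K) M (k + 1)).Dom), ∀ z ∈ ball (0 : Ec K k) r, Φ K k X z ∈ spj K (k + 1) X)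
    (w : (K k : ℕ) → (domSys (F.P K) M (k + 1)).Dom → Site (F.P K) (k + 1) → ℝ) (hw₀ : ∀ K k X t, 0 ≤ w K k X t)
    (hw : ∀ (K k : ℕ) (X : (domSys (F.P K) M (k + 1)).Dom) (l : Fin (F.P K).d) (t : Site (F.P K) (k + 1)) (c : ι'),
      ‖ι K k X (Pi.single l (Pi.single t (bV c)))‖ ≤ w K k X t)
    (htail : ∀ (K k : ℕ) (X : (domSys (F.P K) M (k + 1)).Dom) (t : Site (F.P K) (k + 1)),
      let e : Site (F.P K) (k + 1) → TPt 4 (domCount (F.P K) M (k + 1) * M) := fun x i => (ZMod.cast (x i) : ZMod (domCount (F.P K) M (k + 1) * M))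
      w K k X t ≤ B₃ * Real.exp (-δ₀ * distCT (domCount (F.P K) M (k + 1)) M (e t) (nearT (M := M) (e t) X)))
    (μ ν : Fin 4) :
    WindowedDecay F (localizedSum F S emb) ρ bV W μ ν (delta1 δ₀ κ ((M : ℝ) * 4)) :=
  windowedDecay_localizedSum_of_outputBound F m' M hM S emb ρ bV W (fun K k => spj K (k + 1)) hκ₀ hδ₀ hB₃ hr hB hκE
    (fun g hg K k X φ hφ => by
      have h := hT K g hg (k + 1) X φ hφ
      rwa [termC_succ] at h)
    Ec ι Φ U hU hrU hEhol hΦemb hΦsp w hw₀ hw htail μ ν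

end Letter

end YMDAG.N22.OutputLevel

end
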